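import Summits.NavierStokesRegularity.NavierStokesRegularity.Theorems.ExtremiserTransienceNearExtremalTransienceExtremiserLiouvilleConstantSpeedBlowDownPairing
import HarnessLib

/-!
# Crux `ExtremiserTransience.NearExtremalTransience` (stmt-NavierStokesRegularity-21883), line `extremiser_liouville`,
# stub K1b — THE BLOW-DOWN PAIRING LAW FOR DECAYING (NON-COMPACTLY SUPPORTED) TEST FIELDS

`--supports stmt-NavierStokesRegularity-21883` (helper).  Author: prover seat `ns-el-k1b` (g6).  Generalises g5's
`tendsto_blowDown_pairing` (`…ConstantSpeedBlowDownPairing`, compactly supported solenoidal `Ψ`) to test fields `Ψ` that are only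
BOUNDED with bounded `curl Ψ`, `DΨ` and square-integrable `D curl Ψ` — the class of Newtonian potentials `Ψ = Γ ∗ curl B`,
`B ∈ C_c^∞` (`…ConstantSpeedBlowDownVorticity`), which are never compactly supported.  The multiplier identity for the rescaled
fields `Ψ(R⁻¹·)` is taken as a hypothesis (`hid`); it is discharged for that class in `…ConstantSpeedMultiplierExtension`.

* `tendsto_blowDown_pairing_of_sqIntegrable` : `v` smooth, `‖v‖ ≡ M`, `D¹v, D²v ∈ L²`, `μ` finite, `Ψ ∈ C²` with `‖Ψ‖, ‖curl Ψ‖,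
  ‖DΨ‖ ≤ C` and `∫‖D curl Ψ‖² < ∞`, and the multiplier identity for every `Ψ(R⁻¹·)`, `R ≥ 1`  ⟹
  **`κ⋆² M² W · a₁(Ψ(R⁻¹·)) ⟶ −∫⟪v x, Ψ 0⟫ dμ(x)`** as `R → ∞`.
  The only change w.r.t. g5: `|c₁(Ψ_R)| ≤ (η/2)W + 3∫‖D curl Ψ‖²/(2ηR)` by the substitution `x = Ry` instead of the volume of
  the support.

READING (record `Lines/extremiser_liouville_k1b_jet.md` §6).  With `Ψ = Γ ∗ curl B` one has `a₁(Ψ(R⁻¹·)) = −R⁻¹∫⟪ω, B(R⁻¹x)⟫dx`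
(`ω = curl v`), so the law identifies the distributional limit of the blow-down VORTICITY `ω_R = R²ω(R·)`: it is the vorticity of
the Stokeslet of force `b = ∫ v dμ`; for the residue JET (`b = 0`, g5) every blow-down is irrotational in the limit.

WHAT THIS IS NOT: K1b is NOT proved; nothing here proves NS regularity. [folklore]
-/

noncomputable section

open Set Filter Topology MeasureTheory Metric Function
open scoped ENNReal NNReal Topology InnerProductSpace RealInnerProductSpace ContDiff
open Literature.Analysis.FluidPDE Literature.Analysis

namespace Summit.NavierStokesRegularity.NavierStokesRegularity.Theorems

-- the problem directory repeats the summit name (`NavierStokesRegularity/NavierStokesRegularity`)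
set_option linter.dupNamespace false

namespace ExtremiserLiouville

open DepletionLadder.KStar DepletionLadder.KStar.HalfSpace
open Summit.NavierStokesRegularity.NavierStokesRegularity.Theorems.RungReynoldsOne.WeightedSlice

variable {v Ψ : E3 → E3}

/-- Substitution `x = R y` for the square of a rescaled profile: `∫ g(R⁻¹x) dx = R³ ∫ g` (`R ≥ 0`). [folklore] -/
theorem integral_comp_inv_smul_E3 (g : E3 → ℝ) {R : ℝ} (hR : 0 ≤ R) :
    ∫ x, g (R⁻¹ • x) = R ^ 3 * ∫ y, g y := by
  rw [Measure.integral_comp_inv_smul_of_nonneg volume g hR, finrank_euclideanSpace, Fintype.card_fin, smul_eq_mul]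

/-- **Blow-down pairing law for bounded test fields with square-integrable `D curl`.**  Let `v` be smooth with `‖v‖ ≡ M`,
`D¹v, D²v ∈ L²`, `μ` a finite measure, `Ψ ∈ C²` with `‖Ψ‖, ‖curl Ψ‖, ‖DΨ‖ ≤ C` and `∫‖D curl Ψ‖² < ∞`, and assume the multiplier
identity `S·J₁(Ψ_R) − κ⋆²M²(W a₁(Ψ_R) + Z c₁(Ψ_R)) = ∫⟪v, Ψ_R⟫dμ` for every rescaled field `Ψ_R = Ψ(R⁻¹·)`, `R ≥ 1`.  Then
**`κ⋆²M²W · a₁(Ψ(R⁻¹·)) → −∫⟪v x, Ψ 0⟫dμ(x)`** as `R → ∞`. [folklore] -/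
theorem tendsto_blowDown_pairing_of_sqIntegrable (hv : ContDiff ℝ ∞ v) {M : ℝ} (hM : ∀ x, ‖v x‖ = M)
    (h1 : ∫⁻ x, ‖iteratedFDeriv ℝ 1 v x‖ₑ ^ 2 < ⊤) (h2 : ∫⁻ x, ‖iteratedFDeriv ℝ 2 v x‖ₑ ^ 2 < ⊤)
    (μ : Measure E3) [IsFiniteMeasure μ]
    (hΨ : ContDiff ℝ 2 Ψ) {C : ℝ} (hΨb : ∀ y, ‖Ψ y‖ ≤ C) (hcurlb : ∀ y, ‖curl Ψ y‖ ≤ C)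
    (hDb : ∀ y, ‖fderiv ℝ Ψ y‖ ≤ C) (hDcurl : Integrable (fun y => ‖fderiv ℝ (curl Ψ) y‖ ^ 2) volume)
    (hid : ∀ R : ℝ, 1 ≤ R →
      Jst v * J1 v (fun y => Ψ (R⁻¹ • y)) -
          kStar ^ 2 * M ^ 2 * (Wpa v * A1 v (fun y => Ψ (R⁻¹ • y)) + Zen v * C1 v (fun y => Ψ (R⁻¹ • y))) =
        ∫ x, ⟪v x, Ψ (R⁻¹ • x)⟫_ℝ ∂μ) :
    Tendsto (fun R : ℝ => kStar ^ 2 * M ^ 2 * Wpa v * A1 v (fun y => Ψ (R⁻¹ • y))) atTop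
      (𝓝 (-∫ x, ⟪v x, Ψ 0⟫_ℝ ∂μ)) := by
  -- names
  set K : ℝ := kStar with hK
  set Z : ℝ := Zen v with hZ
  set W : ℝ := Wpa v with hW
  set S : ℝ := Jst v with hS
  have hZ0 : 0 ≤ Z := integral_nonneg fun x => sq_nonneg _
  have hW0 : 0 ≤ W := integral_nonneg fun x => frobeniusNormSq_nonneg _
  have hC0 : 0 ≤ C := (norm_nonneg _).trans (hΨb 0)
  -- integrability of the three global densities
  have IZ : Integrable (fun x => ‖curl v x‖ ^ 2) volume := (integrable_norm_curl_sq (hv.of_le (by norm_cast)) h1).1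
  have IW : Integrable (fun x => frobeniusNormSq (fderiv ℝ (curl v) x)) volume :=
    (integrable_frobeniusNormSq_fderiv_curl (hv.of_le (by norm_cast)) h2).1
  have ID : Integrable (fun x => ‖fderiv ℝ v x‖ ^ 2) volume := by
    have h1' : ∫⁻ x, ‖fderiv ℝ v x‖ₑ ^ 2 < ⊤ := by
      refine lt_of_le_of_lt (le_of_eq (lintegral_congr fun x => ?_)) h1
      rw [← ofReal_norm, ← ofReal_norm, norm_iteratedFDeriv_one]
    exact integrable_sq_norm_of_lintegral_lt_top (hv.continuous_fderiv (by simp)) h1'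
  -- the square integral of `D curl Ψ`
  set I : ℝ := ∫ y, ‖fderiv ℝ (curl Ψ) y‖ ^ 2 with hI
  have hI0 : 0 ≤ I := integral_nonneg fun y => sq_nonneg _
  -- the majorant of the `J₁` density
  set g : E3 → ℝ := fun x => C * (‖fderiv ℝ v x‖ ^ 2 + 2 * ‖curl v x‖ ^ 2) with hg
  have hgi : Integrable g volume := (ID.add (IZ.const_mul 2)).const_mul C
  set G : ℝ := ∫ x, g x with hG
  have hG0 : 0 ≤ G := integral_nonneg fun x => by positivity
  have hΨd : Differentiable ℝ Ψ := hΨ.differentiable (by simp)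
  -- the multiplier side: dominated convergence
  have hμlim := tendsto_integral_inner_rescale hv.continuous hM hΨ.continuous hΨb μ
  rw [Metric.tendsto_atTop] at hμlim ⊢
  intro ε hε
  obtain ⟨Rμ, hRμ⟩ := hμlim (ε / 4) (by positivity)
  -- ε-management for the two small first-variation terms
  set η : ℝ := ε / (2 * (K ^ 2 * M ^ 2 * Z * W + 1)) with hηdef
  have hη : 0 < η := by positivity
  set T : ℝ := |S| * G + K ^ 2 * M ^ 2 * Z * (3 * I / (2 * η)) with hT
  have hT0 : 0 ≤ T := by positivity
  refine ⟨max (max Rμ 1) (4 * T / ε + 1), fun R hR => ?_⟩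
  have hR1 : 1 ≤ R := (le_max_right _ _).trans ((le_max_left _ _).trans hR)
  have hRpos : 0 < R := lt_of_lt_of_le one_pos hR1
  have hRμ' : Rμ ≤ R := (le_max_left _ _).trans ((le_max_left _ _).trans hR)
  have hRT : 4 * T / ε ≤ R := by linarith [(le_max_right _ _).trans hR]
  have hRinv : 0 < R⁻¹ := inv_pos.2 hRpos
  -- the test field `Ψ_R`
  set φ : E3 → E3 := fun y => Ψ (R⁻¹ • y) with hφdef
  -- the multiplier identity for `Ψ_R`
  have hid' := hid R hR1
  set Aφ : ℝ := A1 v φ with hAφ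
  set Jφ : ℝ := J1 v φ with hJφ
  set Cφ : ℝ := C1 v φ with hCφ
  -- bound on `J₁(Ψ_R)`
  have hJ : |Jφ| ≤ G / R := by
    rw [hJφ]
    unfold J1
    have hptw : ∀ x, |⟪curl φ x, fderiv ℝ v x (curl v x)⟫ + ⟪curl v x, fderiv ℝ φ x (curl v x)⟫ +
        ⟪curl v x, fderiv ℝ v x (curl φ x)⟫| ≤ g x / R := by
      intro x
      have hcφ : ‖curl φ x‖ ≤ R⁻¹ * C := by
        rw [hφdef, curl_rescale hΨd, norm_smul, Real.norm_eq_abs, abs_of_pos hRinv]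
        exact mul_le_mul_of_nonneg_left (hcurlb _) hRinv.le
      have hDφ : ‖fderiv ℝ φ x‖ ≤ R⁻¹ * C := by
        rw [hφdef, fderiv_rescale hΨd, norm_smul, Real.norm_eq_abs, abs_of_pos hRinv]
        exact mul_le_mul_of_nonneg_left (hDb _) hRinv.le
      set a := ‖fderiv ℝ v x‖ with ha_def
      set b := ‖curl v x‖ with hb_def
      have ha : 0 ≤ a := norm_nonneg _
      have hb : 0 ≤ b := norm_nonneg _
      have t1 : |⟪curl φ x, fderiv ℝ v x (curl v x)⟫| ≤ R⁻¹ * C * (a * b) := by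
        refine (abs_real_inner_le_norm _ _).trans ?_
        exact mul_le_mul hcφ ((fderiv ℝ v x).le_opNorm _) (norm_nonneg _) (by positivity)
      have t2 : |⟪curl v x, fderiv ℝ φ x (curl v x)⟫| ≤ R⁻¹ * C * (b * b) := by
        refine (abs_real_inner_le_norm _ _).trans ?_
        calc ‖curl v x‖ * ‖fderiv ℝ φ x (curl v x)‖ ≤ b * ((R⁻¹ * C) * b) :=
              mul_le_mul_of_nonneg_left (((fderiv ℝ φ x).le_opNorm _).trans (mul_le_mul_of_nonneg_right hDφ hb)) hb
          _ = R⁻¹ * C * (b * b) := by ring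
      have t3 : |⟪curl v x, fderiv ℝ v x (curl φ x)⟫| ≤ R⁻¹ * C * (a * b) := by
        refine (abs_real_inner_le_norm _ _).trans ?_
        calc ‖curl v x‖ * ‖fderiv ℝ v x (curl φ x)‖ ≤ b * (a * (R⁻¹ * C)) :=
              mul_le_mul_of_nonneg_left (((fderiv ℝ v x).le_opNorm _).trans (mul_le_mul_of_nonneg_left hcφ ha)) hb
          _ = R⁻¹ * C * (a * b) := by ring
      have hsum := (abs_add_le _ _).trans (add_le_add ((abs_add_le _ _).trans (add_le_add t1 t2)) t3)
      have hab : 2 * (a * b) + b ^ 2 ≤ a ^ 2 + 2 * b ^ 2 := by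
        have := two_mul_le_add_sq a b
        linarith only [this]
      calc |⟪curl φ x, fderiv ℝ v x (curl v x)⟫ + ⟪curl v x, fderiv ℝ φ x (curl v x)⟫ + ⟪curl v x, fderiv ℝ v x (curl φ x)⟫|
          ≤ R⁻¹ * C * (a * b) + R⁻¹ * C * (b * b) + R⁻¹ * C * (a * b) := hsum
        _ = R⁻¹ * C * (2 * (a * b) + b ^ 2) := by ring
        _ ≤ R⁻¹ * C * (a ^ 2 + 2 * b ^ 2) := mul_le_mul_of_nonneg_left hab (mul_nonneg hRinv.le hC0)
        _ = g x / R := by rw [hg, ha_def, hb_def, div_eq_inv_mul]; ring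
    refine (abs_integral_le_integral_abs).trans ?_
    have hgi' : Integrable (fun x => g x / R) volume := hgi.div_const R
    calc (∫ x, |⟪curl φ x, fderiv ℝ v x (curl v x)⟫ + ⟪curl v x, fderiv ℝ φ x (curl v x)⟫ + ⟪curl v x, fderiv ℝ v x (curl φ x)⟫|)
        ≤ ∫ x, g x / R := integral_mono_of_nonneg (Eventually.of_forall fun x => abs_nonneg _) hgi'
            (Eventually.of_forall hptw)
      _ = G / R := by rw [integral_div]
  -- bound on `c₁(Ψ_R)`: `(η/2)W + 3 I/(2η R)` by the substitution `x = R y`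
  have hCb : |Cφ| ≤ η / 2 * W + 3 * I / (2 * η) / R := by
    rw [hCφ]
    unfold C1
    set q : E3 → ℝ := fun x => ‖fderiv ℝ (curl Ψ) (R⁻¹ • x)‖ ^ 2 with hq
    have hqi : Integrable q volume := by
      have h := hDcurl.comp_smul (inv_ne_zero hRpos.ne')
      exact h
    have hqint : ∫ x, q x = R ^ 3 * I := by
      rw [hq, hI]
      exact integral_comp_inv_smul_E3 (fun y => ‖fderiv ℝ (curl Ψ) y‖ ^ 2) hRpos.le
    have hptw : ∀ x, |∑ i, ⟪fderiv ℝ (curl v) x (EuclideanSpace.basisFun (Fin 3) ℝ i),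
        fderiv ℝ (curl φ) x (EuclideanSpace.basisFun (Fin 3) ℝ i)⟫| ≤
        η / 2 * frobeniusNormSq (fderiv ℝ (curl v) x) + 1 / (2 * η) * (3 * (R⁻¹ * R⁻¹) ^ 2 * q x) := by
      intro x
      have hη' : 0 ≤ 1 / (2 * η) := by rw [one_div]; exact (inv_pos.2 (by linarith only [hη])).le
      refine (sum_inner_le_frobeniusNormSq (fderiv ℝ (curl v) x) (fderiv ℝ (curl φ) x) hη).trans
        (add_le_add le_rfl (mul_le_mul_of_nonneg_left ?_ hη'))
      refine (BradshawTsai2017.frobeniusNormSq_le_three_mul_norm_sq _).trans (le_of_eq ?_)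
      rw [hφdef, fderiv_curl_rescale hΨ, norm_smul, norm_smul, Real.norm_eq_abs, abs_of_pos hRinv, hq]
      ring
    have hmaj_int : Integrable (fun x => η / 2 * frobeniusNormSq (fderiv ℝ (curl v) x) +
        1 / (2 * η) * (3 * (R⁻¹ * R⁻¹) ^ 2 * q x)) volume :=
      (IW.const_mul _).add ((hqi.const_mul _).const_mul _)
    refine (abs_integral_le_integral_abs).trans ((integral_mono_of_nonneg (Eventually.of_forall fun x => abs_nonneg _)
      hmaj_int (Eventually.of_forall hptw)).trans (le_of_eq ?_))
    rw [integral_add (IW.const_mul _) ((hqi.const_mul _).const_mul _), integral_const_mul, integral_const_mul,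
      integral_const_mul, hqint]
    have hWdef : (∫ a, frobeniusNormSq (fderiv ℝ (curl v) a)) = W := by rw [hW]; rfl
    rw [hWdef]
    field_simp
  -- the multiplier term
  have hμR : |(∫ x, ⟪v x, φ x⟫_ℝ ∂μ) - ∫ x, ⟪v x, Ψ 0⟫_ℝ ∂μ| < ε / 4 := by
    have h := hRμ R hRμ'
    rwa [Real.dist_eq] at h
  -- assemble: `K²M²W·A1 = S·J1 − K²M²Z·C1 − ∫⟪v,φ⟫dμ`
  have hmain : K ^ 2 * M ^ 2 * W * Aφ = S * Jφ - K ^ 2 * M ^ 2 * Z * Cφ - ∫ x, ⟪v x, φ x⟫_ℝ ∂μ := by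
    rw [hAφ, hJφ, hCφ]; linarith [hid']
  have hJterm : |S * Jφ| ≤ |S| * G / R := by
    rw [abs_mul]
    have := mul_le_mul_of_nonneg_left hJ (abs_nonneg S)
    have e : |S| * (G / R) = |S| * G / R := by ring
    linarith only [this, e]
  have hKMZ : 0 ≤ K ^ 2 * M ^ 2 * Z := by positivity
  have hCterm : |K ^ 2 * M ^ 2 * Z * Cφ| ≤
      K ^ 2 * M ^ 2 * Z * (η / 2 * W) + K ^ 2 * M ^ 2 * Z * (3 * I / (2 * η)) / R := by
    rw [abs_mul, abs_of_nonneg hKMZ]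
    have := mul_le_mul_of_nonneg_left hCb hKMZ
    have e : K ^ 2 * M ^ 2 * Z * (η / 2 * W + 3 * I / (2 * η) / R) =
        K ^ 2 * M ^ 2 * Z * (η / 2 * W) + K ^ 2 * M ^ 2 * Z * (3 * I / (2 * η)) / R := by ring
    linarith only [this, e]
  have hP2 : 0 ≤ K ^ 2 * M ^ 2 * Z * W := by positivity
  have hε2 : K ^ 2 * M ^ 2 * Z * (η / 2 * W) ≤ ε / 4 := by
    have e : K ^ 2 * M ^ 2 * Z * (η / 2 * W) = (K ^ 2 * M ^ 2 * Z * W) * ε / (4 * (K ^ 2 * M ^ 2 * Z * W + 1)) := by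
      rw [hηdef]; field_simp; ring
    rw [e, div_le_div_iff₀ (by positivity) (by positivity)]
    nlinarith only [hP2, hε.le]
  have hε3 : |S| * G / R + K ^ 2 * M ^ 2 * Z * (3 * I / (2 * η)) / R ≤ ε / 4 := by
    rw [← add_div, ← hT, div_le_iff₀ hRpos]
    have h := hRT
    rw [div_le_iff₀ hε] at h
    linarith only [h]
  rw [Real.dist_eq]
  have e : K ^ 2 * M ^ 2 * W * Aφ - -∫ x, ⟪v x, Ψ 0⟫_ℝ ∂μ =
      S * Jφ - K ^ 2 * M ^ 2 * Z * Cφ - ((∫ x, ⟪v x, φ x⟫_ℝ ∂μ) - ∫ x, ⟪v x, Ψ 0⟫_ℝ ∂μ) := by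
    rw [hmain]; ring
  rw [e]
  have hfin := (abs_sub _ _).trans (add_le_add ((abs_sub _ _).trans (add_le_add hJterm hCterm)) hμR.le)
  linarith only [hfin, hε2, hε3, hμR, hε]

/-- The same law with the barycentre `b = ∫ v dμ` on the right: `κ⋆²M²W·a₁(Ψ(R⁻¹·)) → −⟪Ψ 0, b⟫`. [folklore] -/
theorem tendsto_blowDown_pairing_of_sqIntegrable' (hv : ContDiff ℝ ∞ v) {M : ℝ} (hM : ∀ x, ‖v x‖ = M)
    (h1 : ∫⁻ x, ‖iteratedFDeriv ℝ 1 v x‖ₑ ^ 2 < ⊤) (h2 : ∫⁻ x, ‖iteratedFDeriv ℝ 2 v x‖ₑ ^ 2 < ⊤)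
    (μ : Measure E3) [IsFiniteMeasure μ]
    (hΨ : ContDiff ℝ 2 Ψ) {C : ℝ} (hΨb : ∀ y, ‖Ψ y‖ ≤ C) (hcurlb : ∀ y, ‖curl Ψ y‖ ≤ C)
    (hDb : ∀ y, ‖fderiv ℝ Ψ y‖ ≤ C) (hDcurl : Integrable (fun y => ‖fderiv ℝ (curl Ψ) y‖ ^ 2) volume)
    (hid : ∀ R : ℝ, 1 ≤ R →
      Jst v * J1 v (fun y => Ψ (R⁻¹ • y)) -
          kStar ^ 2 * M ^ 2 * (Wpa v * A1 v (fun y => Ψ (R⁻¹ • y)) + Zen v * C1 v (fun y => Ψ (R⁻¹ • y))) =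
        ∫ x, ⟪v x, Ψ (R⁻¹ • x)⟫_ℝ ∂μ) :
    Tendsto (fun R : ℝ => kStar ^ 2 * M ^ 2 * Wpa v * A1 v (fun y => Ψ (R⁻¹ • y))) atTop
      (𝓝 (-⟪Ψ 0, ∫ x, v x ∂μ⟫_ℝ)) := by
  have hvi : Integrable v μ :=
    (integrable_const M).mono' hv.continuous.aestronglyMeasurable (Eventually.of_forall fun x => (hM x).le)
  have e : (∫ x, ⟪v x, Ψ 0⟫_ℝ ∂μ) = ⟪Ψ 0, ∫ x, v x ∂μ⟫_ℝ := by
    rw [← integral_inner hvi]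
    exact integral_congr_ae (Eventually.of_forall fun x => real_inner_comm _ _)
  rw [← e]
  exact tendsto_blowDown_pairing_of_sqIntegrable hv hM h1 h2 μ hΨ hΨb hcurlb hDb hDcurl hid

end ExtremiserLiouville

end Summit.NavierStokesRegularity.NavierStokesRegularity.Theorems

end
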